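import Mathlib.Data.Finsupp.Basic
import Mathlib.Algebra.BigOperators.Group.Finset.Basic
import Literature.NumberTheory.Transcendental.MZVWordShuffle
import HarnessLib

/-!
# Shuffle regularisation of binary words onto convergent words (IKZ `reg_ш` at `T = 0`)

Definition file (request `defn-MZV.shuffleReg`, route KontsevichZagierPeriods/FurushoPentagon: items
`PentagonInKZ` stmt-4110, `FurushoTransfer` stmt-5054, later `RegularisedDoubleShuffleInKZ`).
Pure word combinatorics over `ℚ` in the tree's conventions (`MZVSimplexRep.lean`,
`MZVWordShuffle.lean`): a word is a `List Bool`, `false` = the letter `x` (form `dt/t`), `true` =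
the letter `y` (form `dt/(1-t)`); `MZV.shuffleWord u v` lists the interleavings `u ш v` with
multiplicity; `𝔥 = ℚ⟨x,y⟩` is realised as `List Bool →₀ ℚ`, `𝔥¹ = ℚ + 𝔥y` (words ending in `y`),
`𝔥⁰ = ℚ + x𝔥y` (CONVERGENT words: empty, or first letter `x` and last letter `y`).

## Source and formulas

K. Ihara, M. Kaneko, D. Zagier, *Derivation and double shuffle relations for multiple zeta values*,
Compositio Math. 142 (2006) 307–338 [IKZ]: §3 (p. 314) "Denote by `reg_ш^T` the map (actually
an isomorphism) `𝔥¹ → 𝔥⁰[T]` defined by the properties that it is the identity on `𝔥⁰`, maps `y` to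
`T`, and is an algebra homomorphism [for `ш`; `𝔥¹ ≅ 𝔥⁰[y]`, Prop. 1 with [Reu93]]. The map
`𝔥¹ → 𝔥⁰` obtained by specializing to `T = 0` will be denoted by `reg_ш`"; and **Corollary 5
(explicit regularization formula, p. 322)**: for `w = y^m w₀`, `w₀ ∈ 𝔥⁰`,

  `reg_ш(w) = ∑_{i=0}^{m} (-1)^i  y^i ш (y^{m-i} w₀)`.

The route needs the TWO-SIDED regularisation on all of `𝔥 = 𝔥⁰[x, y]` (shuffle-polynomial algebra
over `𝔥⁰` in the letters `x` at the END and `y` at the FRONT; Reutenauer 1993, §6; Furusho 2003,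
§3 for the coefficients of `Φ_KZ`): identity on `𝔥⁰`, shuffle homomorphism, `reg(x) = reg(y) = 0`.
It is the composite of the two one-sided specialisations, each given by the Corollary-5 formula
(the end version is its mirror image under word reversal, an automorphism of `ш`): with
`m` = number of leading `y`'s and `n` = number of trailing `x`'s of `w`,

* `MZV.regFront w = ∑_{i=0}^{m} (-1)^i  y^i ш (w minus its first i letters)`   (IKZ Cor. 5),
* `MZV.regEnd w   = ∑_{k=0}^{n} (-1)^k  x^k ш (w minus its last k letters)`    (mirror),
* `MZV.shuffleReg w = regFront (regEnd w)` (extended linearly), a finite `ℚ`-combination of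
  convergent words; `MZV.shuffleRegFS` its linear extension to `𝔥`, and `MZV.shuffleRegIndex` the
  index form `reg_ш : 𝔥¹ → 𝔥⁰` of IKZ (`T = 0`) through `binaryWord` / `ofBinaryWord`.

(Why the Taylor form is the characterised map: "remove the last letter if it is `x`" is a
`ш`-derivation `δ` with `δ(x) = 1` vanishing on words ending in `y`, so on `𝔥 = 𝔥_y[x]` it is
`d/dx`, and the constant-term map is `∑_k (-1)^k x^{шk}/k! ш δ^k = ∑_k (-1)^k x^k ш δ^k` since
`x^{шk} = k! x^k`; likewise at the front with `y`.)

## API proved here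

`shuffleReg_of_isConvergentWord` (identity on `𝔥⁰`), `shuffleReg_x`, `shuffleReg_y`
(`reg(x) = reg(y) = 0`), the defining sums unfolded (`regEnd`, `regFront` are literally the
Corollary-5 sums, so small cases evaluate by `simp [Finset.sum_range_succ]`), the worked example
`shuffleReg_yx : reg(yx) = -xy`, and `shuffleRegIndex` of an admissible index. NOT proved here
(wanted by the route, to be supplied as `--supports` lemmas): multiplicativity
`reg(u ш v) = reg(u) ш reg(v)` (the derivation/Taylor argument above) and IKZ Thm. 2
(iii)⇔(iv)⇔(v); no named fact is introduced.

## References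

* K. Ihara, M. Kaneko, D. Zagier, Compositio Math. 142 (2006), §2 Prop. 1, §3 p. 314, Cor. 5
  p. 322. [IharaKanekoZagier2006]
* C. Reutenauer, *Free Lie Algebras* (1993), §6 (the shuffle algebra is free polynomial).
  [Reutenauer1993]
* H. Furusho, *The multiple zeta value algebra and the stable derivation algebra*, Publ. RIMS 39
  (2003), §3 (two-sided regularisation of the coefficients of `Φ_KZ`). [Furusho2003]
-/

noncomputable section

open Finsupp Finset

namespace Literature.NumberTheory.Transcendental

namespace MZV

/-! ### Words as elements of `𝔥 = ℚ⟨x, y⟩ = List Bool →₀ ℚ` -/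

/-- The element `∑_{w ∈ L} w` of `𝔥 = ℚ⟨x,y⟩` (free `ℚ`-module on binary words) of a list of words
with multiplicity. [cite: IharaKanekoZagier2006, §1 (𝔥 = ℚ⟨x,y⟩)] -/
def wordSum (L : List (List Bool)) : List Bool →₀ ℚ :=
  (L.map fun w => Finsupp.single w (1 : ℚ)).sum

/-- `wordSum [] = 0`. [cite: IharaKanekoZagier2006, §1] -/
@[simp] theorem wordSum_nil : wordSum [] = 0 := rfl

/-- `wordSum (w :: L) = w + wordSum L`. [cite: IharaKanekoZagier2006, §1] -/
@[simp] theorem wordSum_cons (w : List Bool) (L : List (List Bool)) :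
    wordSum (w :: L) = Finsupp.single w 1 + wordSum L := by
  simp [wordSum]

/-- `wordSum (L ++ L') = wordSum L + wordSum L'`. [cite: IharaKanekoZagier2006, §1] -/
theorem wordSum_append (L L' : List (List Bool)) : wordSum (L ++ L') = wordSum L + wordSum L' := by
  simp [wordSum, List.sum_append]

/-- Prefixing every word of a list by a letter is `mapDomain (cons a)` on its sum. [cite: IharaKanekoZagier2006, §1] -/
theorem wordSum_map_cons (a : Bool) (L : List (List Bool)) :
    wordSum (L.map (List.cons a)) = (wordSum L).mapDomain (List.cons a) := by
  induction L with
  | nil => simp [wordSum, Finsupp.mapDomain_zero]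
  | cons w L ih =>
    rw [List.map_cons, wordSum_cons, wordSum_cons, ih, Finsupp.mapDomain_add,
      Finsupp.mapDomain_single]

/-- The shuffle product `u ш v ∈ 𝔥` of two words (`MZV.shuffleWord` summed with multiplicity).
[cite: IharaKanekoZagier2006, §1 (shuffle product ш)] -/
def shuffleSum (u v : List Bool) : List Bool →₀ ℚ := wordSum (shuffleWord u v)

/-- `[] ш v = v`. [cite: IharaKanekoZagier2006, §1] -/
@[simp] theorem shuffleSum_nil_left (v : List Bool) : shuffleSum [] v = Finsupp.single v 1 := by
  simp [shuffleSum]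

/-- `u ш [] = u`. [cite: IharaKanekoZagier2006, §1] -/
@[simp] theorem shuffleSum_nil_right (u : List Bool) : shuffleSum u [] = Finsupp.single u 1 := by
  simp [shuffleSum]

/-- The recursion `(a u) ш (b v) = a (u ш b v) + b (a u ш v)` in `𝔥`. [cite: IharaKanekoZagier2006, §1] -/
theorem shuffleSum_cons_cons (a b : Bool) (u v : List Bool) :
    shuffleSum (a :: u) (b :: v) =
      (shuffleSum u (b :: v)).mapDomain (List.cons a) +
        (shuffleSum (a :: u) v).mapDomain (List.cons b) := by
  simp only [shuffleSum, shuffleWord_cons_cons, wordSum_append, wordSum_map_cons]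

/-- The `ℚ`-bilinear extension of the shuffle product to `𝔥`. [cite: IharaKanekoZagier2006, §1] -/
def shuffleFS (f g : List Bool →₀ ℚ) : List Bool →₀ ℚ :=
  f.sum fun u a => g.sum fun v b => (a * b) • shuffleSum u v

/-! ### Convergent words and the one-sided regularisations -/

/-- A word is CONVERGENT (lies in `𝔥⁰ = ℚ + x 𝔥 y`) iff it is empty or begins with `x` and ends
with `y`. [cite: IharaKanekoZagier2006, §1 (𝔥⁰ = ℚ + x𝔥y)] -/
def IsConvergentWord (w : List Bool) : Prop :=
  w = [] ∨ (w.head? = some false ∧ w.getLast? = some true)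

/-- Decidability of convergence (for `decide` on examples). [cite: IharaKanekoZagier2006, §1] -/
instance (w : List Bool) : Decidable (IsConvergentWord w) := by
  unfold IsConvergentWord; infer_instance

/-- The number `m` of leading letters `y` of a word (`w = y^m w'`, `w'` not starting with `y`). [cite: IharaKanekoZagier2006, Cor. 5 (w = y^m w₀)] -/
def leadingY (w : List Bool) : ℕ := (w.takeWhile fun b => b).length

/-- The number `n` of trailing letters `x` of a word (`w = w' x^n`, `w'` not ending with `x`). [cite: IharaKanekoZagier2006, Cor. 5 (mirror image)] -/
def trailingX (w : List Bool) : ℕ := (w.reverse.takeWhile fun b => !b).length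

/-- **IKZ's explicit regularisation at the front** (Cor. 5 with `T = 0`): for `w = y^m w'`,
`regFront w = ∑_{i=0}^{m} (-1)^i y^i ш (w minus its first i letters)`; it kills the leading `y`'s
(`reg_ш : 𝔥¹ → 𝔥⁰` when `w ∈ 𝔥¹`). [cite: IharaKanekoZagier2006, Cor. 5 p. 322] -/
def regFront (w : List Bool) : List Bool →₀ ℚ :=
  ∑ i ∈ range (leadingY w + 1), ((-1 : ℚ) ^ i) • shuffleSum (List.replicate i true) (w.drop i)

/-- **The mirror formula at the end**: for `w = w' x^n`,
`regEnd w = ∑_{k=0}^{n} (-1)^k x^k ш (w minus its last k letters)`; it kills the trailing `x`'s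
(constant term in `𝔥 = 𝔥_y[x]`). [cite: IharaKanekoZagier2006, Cor. 5 p. 322 (mirror image under word reversal)] -/
def regEnd (w : List Bool) : List Bool →₀ ℚ :=
  ∑ k ∈ range (trailingX w + 1),
    ((-1 : ℚ) ^ k) • shuffleSum (List.replicate k false) (w.take (w.length - k))

/-- **The two-sided shuffle regularisation** `reg : ℚ⟨x,y⟩ → 𝔥⁰` on a word: `regFront` applied
(linearly) to `regEnd w` — the unique `ш`-homomorphism which is the identity on `𝔥⁰` and kills `x`
and `y` (`𝔥 = 𝔥⁰[x, y]`), as a finite `ℚ`-combination of convergent words.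
[cite: IharaKanekoZagier2006, §3 p. 314 (reg_ш) with Cor. 5] -/
def shuffleReg (w : List Bool) : List Bool →₀ ℚ :=
  (regEnd w).sum fun u a => a • regFront u

/-- The `ℚ`-linear extension of `shuffleReg` to `𝔥`. [cite: IharaKanekoZagier2006, §3 p. 314] -/
def shuffleRegFS (f : List Bool →₀ ℚ) : List Bool →₀ ℚ :=
  f.sum fun w a => a • shuffleReg w

/-- **IKZ's `reg_ш : 𝔥¹ → 𝔥⁰` on indices** (`T = 0`): the index `k = (k₁, …, k_n)` is the word
`x^{k₁-1} y ⋯ x^{k_n-1} y ∈ 𝔥¹` (`binaryWord`), regularised and read back as indices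
(`ofBinaryWord`). [cite: IharaKanekoZagier2006, §3 p. 314 (reg_ш, T = 0)] -/
def shuffleRegIndex (k : List ℕ) : List ℕ →₀ ℚ :=
  (shuffleReg (binaryWord k)).mapDomain ofBinaryWord

/-! ### API -/

/-- A word ending with `y` has no trailing `x`. [cite: IharaKanekoZagier2006, Cor. 5] -/
theorem trailingX_eq_zero {w : List Bool} (h : w.getLast? = some true) : trailingX w = 0 := by
  unfold trailingX
  rw [List.getLast?_eq_head?_reverse] at h
  rcases hr : w.reverse with _ | ⟨b, l⟩
  · simp
  · rw [hr] at h
    simp only [List.head?_cons, Option.some.injEq] at h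
    subst h
    simp

/-- A word beginning with `x` has no leading `y`. [cite: IharaKanekoZagier2006, Cor. 5] -/
theorem leadingY_eq_zero {w : List Bool} (h : w.head? = some false) : leadingY w = 0 := by
  unfold leadingY
  rcases w with _ | ⟨b, l⟩
  · simp
  · simp only [List.head?_cons, Option.some.injEq] at h
    subst h
    simp

/-- `leadingY [] = 0`. [cite: IharaKanekoZagier2006, Cor. 5] -/
@[simp] theorem leadingY_nil : leadingY [] = 0 := rfl

/-- `trailingX [] = 0`. [cite: IharaKanekoZagier2006, Cor. 5] -/
@[simp] theorem trailingX_nil : trailingX [] = 0 := rfl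

/-- Without trailing `x` the end regularisation does nothing. [cite: IharaKanekoZagier2006, Cor. 5] -/
theorem regEnd_of_trailingX_eq_zero {w : List Bool} (h : trailingX w = 0) :
    regEnd w = Finsupp.single w 1 := by
  simp [regEnd, h]

/-- Without leading `y` the front regularisation does nothing. [cite: IharaKanekoZagier2006, Cor. 5] -/
theorem regFront_of_leadingY_eq_zero {w : List Bool} (h : leadingY w = 0) :
    regFront w = Finsupp.single w 1 := by
  simp [regFront, h]

/-- **`reg` is the identity on convergent words** (on `𝔥⁰`). [cite: IharaKanekoZagier2006, §3 p. 314 ("the identity on 𝔥⁰")] -/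
theorem shuffleReg_of_isConvergentWord {w : List Bool} (h : IsConvergentWord w) :
    shuffleReg w = Finsupp.single w 1 := by
  rcases h with rfl | ⟨hh, hl⟩
  · simp [shuffleReg, regEnd, regFront, Finsupp.sum_single_index]
  · rw [shuffleReg, regEnd_of_trailingX_eq_zero (trailingX_eq_zero hl),
      Finsupp.sum_single_index (by simp), one_smul,
      regFront_of_leadingY_eq_zero (leadingY_eq_zero hh)]

/-- **`reg(x) = 0`.** [cite: IharaKanekoZagier2006, §3 p. 314] -/
theorem shuffleReg_x : shuffleReg [false] = 0 := by
  have h : regEnd [false] = 0 := by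
    simp [regEnd, trailingX, Finset.sum_range_succ]
  simp [shuffleReg, h]

/-- **`reg(y) = 0`.** [cite: IharaKanekoZagier2006, §3 p. 314 ("maps y to T", T = 0)] -/
theorem shuffleReg_y : shuffleReg [true] = 0 := by
  have h₁ : regEnd [true] = Finsupp.single [true] 1 :=
    regEnd_of_trailingX_eq_zero (trailingX_eq_zero rfl)
  have h₂ : regFront [true] = 0 := by
    simp [regFront, leadingY, Finset.sum_range_succ]
  rw [shuffleReg, h₁, Finsupp.sum_single_index (by simp), one_smul, h₂]

/-- Worked example: **`reg(yx) = -xy`** (`regEnd (yx) = yx - x ш y = -xy`, then `xy ∈ 𝔥⁰`).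
[cite: IharaKanekoZagier2006, Cor. 5] -/
theorem shuffleReg_yx : shuffleReg [true, false] = -Finsupp.single [false, true] 1 := by
  have h₁ : regEnd [true, false] = -Finsupp.single [false, true] 1 := by
    simp only [regEnd, trailingX, List.reverse_cons, List.reverse_nil, List.nil_append,
      List.cons_append, Bool.not_false, List.takeWhile_cons_of_pos, Bool.not_true,
      Bool.false_eq_true, not_false_eq_true, List.takeWhile_cons_of_neg, List.length_cons,
      List.length_nil, zero_add, Finset.sum_range_succ, Finset.range_one, Finset.sum_singleton,
      pow_zero, one_smul, List.replicate_zero, shuffleSum_nil_left, Nat.reduceAdd, pow_one,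
      List.replicate_one, List.take]
    rw [shuffleSum_cons_cons, shuffleSum_nil_left, shuffleSum_nil_right,
      Finsupp.mapDomain_single, Finsupp.mapDomain_single]
    simp only [neg_smul, one_smul, neg_add_rev]
    abel
  rw [shuffleReg, h₁, Finsupp.sum_neg_index (by simp), Finsupp.sum_single_index (by simp),
    regFront_of_leadingY_eq_zero (leadingY_eq_zero rfl), neg_smul, one_smul]

/-- The binary word of a nonempty index with positive entries ends with `y` (lies in `𝔥¹`).
[cite: IharaKanekoZagier2006, §1 (z_k = x^{k-1} y)] -/
theorem getLast?_binaryWord : ∀ {k : List ℕ}, k ≠ [] → (binaryWord k).getLast? = some true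
  | [], hk => absurd rfl hk
  | [a], _ => by simp [binaryWord]
  | a :: b :: s, _ => by
    have h₂ : binaryWord (b :: s) ≠ [] := by simp [binaryWord]
    rw [binaryWord, List.append_assoc,
      List.getLast?_append_of_ne_nil _ (by simp : [true] ++ binaryWord (b :: s) ≠ []),
      List.getLast?_append_of_ne_nil _ h₂]
    exact getLast?_binaryWord (List.cons_ne_nil b s)

/-- The binary word of an index with `k₁ ≥ 2` begins with `x`. [cite: IharaKanekoZagier2006, §1] -/
theorem head?_binaryWord {a : ℕ} {s : List ℕ} (ha : 2 ≤ a) :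
    (binaryWord (a :: s)).head? = some false := by
  rw [binaryWord]
  obtain ⟨m, rfl⟩ : ∃ m, a = m + 2 := ⟨a - 2, by omega⟩
  simp [List.replicate_succ]

/-- **On admissible indices `reg_ш` is the identity**: for `k = (k₁, …, k_n)` with `k₁ ≥ 2` and all
`kᵢ ≥ 1`, `shuffleRegIndex k = k`. [cite: IharaKanekoZagier2006, §3 p. 314] -/
theorem shuffleRegIndex_of_admissible {a : ℕ} {s : List ℕ} (ha : 2 ≤ a) (hs : ∀ i ∈ s, 1 ≤ i) :
    shuffleRegIndex (a :: s) = Finsupp.single (a :: s) 1 := by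
  have hconv : IsConvergentWord (binaryWord (a :: s)) :=
    Or.inr ⟨head?_binaryWord ha, getLast?_binaryWord (List.cons_ne_nil a s)⟩
  rw [shuffleRegIndex, shuffleReg_of_isConvergentWord hconv, Finsupp.mapDomain_single,
    ofBinaryWord_binaryWord]
  intro i hi
  simp only [List.mem_cons] at hi
  rcases hi with rfl | hi
  · omega
  · exact hs i hi

end MZV

end Literature.NumberTheory.Transcendental

end
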